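import Summits.Ventures.HodgeRepro2.T6N43Fock
import Summits.Ventures.HodgeRepro2.T6N43FockU2
import Summits.Ventures.HodgeRepro2.T6N43Lfac

/-!
# T6N43Explicit — N4.3 on EXPLICIT local data: the (I-P2) binders become definitional

Record: TIER5 §N4.3 (N4.3.P2) at the three real places (v0.51 ll. 1284–1286 and l. 1284 at τ′₁; row R3.7:
«π₀,τ′_j := the U(W_A)_{τ′_j}-submodule of the Fock space generated by φ_{A,τ′_j}, which is ALSO how
π₀,τ′_j is defined in §10.4 … so f_{τ′_j} ↔ φ_{A,τ′_j} under the identification»). In the accepted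
kernel the two coefficients of an `ArchDoublingDatum` are abstract fields and (N4.3.P2) is the interface
Prop `FockLineIdentification` (τ′₂, τ′₃) / `CharacterCoefficient` (τ′₁) — residual class AD on the M2
line (route/T6-N43-t6-p6.md §9 / §11.1), reduced by T6N43Fock / T6N43FockU2 to «the datum's coefficients
ARE the Fock-model ones». This file takes the last step of that reduction, the t6-p5 «explicit shape»
pattern of the N2 datum (STATUS l. 5381 (1): `N2_main_explicit`, «the record's datum is its own
construction»): a datum whose coefficients are DEFINED as the matrix coefficients of the Fock-line action
(`ArchDoublingDatum.ofFockLine`) or of the [KK07] action on `Δ` (`ArchDoublingDatum.ofFockU2`) satisfies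
the interface Prop BY CONSTRUCTION (`ofFockLine_fockLineIdentification`, `ofFockU2_characterCoefficient`:
no hypothesis), and the bundle `N43Places.ExplicitPlaces` of three such data gives THEOREM N4.3 at all
three places with NO (I-P2) binder (`N43_places_explicit`, `N43_places_explicit_withLfac`): per side the
AD class of N4.3 is 3 on an abstract `N43Places` and 0 on `ExplicitPlaces.toPlaces`. What moves into the
construction is exactly R3.7's identification (the M2 carrier's local datum at τ′ is the Fock-line datum
with the forced vector on the line) — declared here, never asserted of an instance. The remaining binders
are unchanged: the displays `Hyp.EischenLiu2024_Sec2_2` (×3) and `Hyp.Ruhl1970_A2f` (×2), and the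
interface residual `LowestWeightCoefficient` (×2, class IR, reducible to a `UnitaryModel` by
T6N43Bargmann). Non-vacuity (README §10.5(ii)(c)/(d)) is T6N43ExplicitToy.lean: `N43Toy.explicitToy` realises the
accepted toys `N43Toy.toyU2` / `N43Toy.toyU11` as explicit data and
`explicit_binders_jointly_satisfiable` witnesses the seven remaining binders at once. Axioms: {propext, Classical.choice, Quot.sound}. §8(d): uses an
L-value-free non-vanishing device: NO.
-/

namespace Summit.Ventures.HodgeRepro2.T6

open MeasureTheory Complex
open scoped InnerProductSpace

namespace ArchDoublingDatum

variable {H : Type*} [MeasurableSpace H] {P : Matrix (Fin 2) (Fin 2) ℂ → Prop}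
  {E : Type*} [NormedAddCommGroup E] [InnerProductSpace ℂ E]

/-- [definition: the EXPLICIT local doubling datum at a (1,1)-place — TIER5 (N4.3.P2) / R3.7 read as a
construction: the coefficients are the diagonal matrix coefficients `g ↦ ⟪φ, ω(g)φ⟫` and
`g ↦ ⟪f, ω(g)f⟫` of the Fock-line datum `F` (the action `ω` of `H = U(W_A)(ℝ)_{τ′}` on the Fock model,
the Fock vector `φ`, the forced vector `f = c • φ` on its line), the norms are `‖φ‖`, `‖f‖`; the Haar
measure `μ`, the matrix map `rep` and the L-factor `Lfac` are the datum's own fields as in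
T6N43Datum.lean.] -/
noncomputable def ofFockLine (F : FockLineDatum H E) (hφ : F.φ ≠ 0) (hf : F.f ≠ 0) (μ : Measure H)
    (rep : H → Matrix (Fin 2) (Fin 2) ℂ) (rep_mem : ∀ g, P (rep g))
    (rep_measurable : ∀ i j, Measurable fun g => rep g i j) (Lfac : ℂ → ℂ) :
    ArchDoublingDatum H P where
  μ := μ
  rep := rep
  rep_mem := rep_mem
  rep_measurable := rep_measurable
  coeffW g := ⟪F.φ, F.ω g F.φ⟫_ℂ
  coeffπ g := ⟪F.f, F.ω g F.f⟫_ℂ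
  normφ := ‖F.φ‖
  normf := ‖F.f‖
  normφ_pos := norm_pos_iff.mpr hφ
  normf_pos := norm_pos_iff.mpr hf
  Lfac := Lfac

/-- (N4.3.P2) at a (1,1)-place holds BY CONSTRUCTION on the explicit datum: no hypothesis
(`fockLineIdentification_of_line` with its four identities `rfl`). -/
theorem ofFockLine_fockLineIdentification (F : FockLineDatum H E) (hφ : F.φ ≠ 0) (hf : F.f ≠ 0)
    (μ : Measure H) (rep : H → Matrix (Fin 2) (Fin 2) ℂ) (rep_mem : ∀ g, P (rep g))
    (rep_measurable : ∀ i j, Measurable fun g => rep g i j) (Lfac : ℂ → ℂ) :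
    (ofFockLine F hφ hf μ rep rep_mem rep_measurable Lfac).FockLineIdentification :=
  fockLineIdentification_of_line _ F (fun _ => rfl) (fun _ => rfl) rfl rfl

/-- The explicit datum's `eta` is the Cartan parameter of `rep` (the same expression as for any datum
with this `rep`). -/
theorem ofFockLine_eta (F : FockLineDatum H E) (hφ : F.φ ≠ 0) (hf : F.f ≠ 0) (μ : Measure H)
    (rep : H → Matrix (Fin 2) (Fin 2) ℂ) (rep_mem : ∀ g, P (rep g))
    (rep_measurable : ∀ i j, Measurable fun g => rep g i j) (Lfac : ℂ → ℂ) (g : H) :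
    (ofFockLine F hφ hf μ rep rep_mem rep_measurable Lfac).eta g = 2 * Real.arsinh ‖rep g 1 0‖ :=
  rfl

/-- [definition: the EXPLICIT local doubling datum at the compact place τ′₁ — TIER5 (N4.3.P2) (j = 1) /
(N4.3.P2-bis) (τ′₁) read as a construction on the polynomial Fock model of T6N43FockU2.lean: the
coefficients are the matrix coefficients of the [KK07] Lemma 5.2(i) action `fockActU2 m` on the Fock
vector `Δ` and on the forced vector `c • Δ`, read through a linear map `ι : FockPoly →ₗ[ℂ] E` into a
Hilbert space (the Fock inner product); the norms are `‖ι Δ‖`, `‖ι (c • Δ)‖`; `rep` takes values in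
`U(2)`.] -/
noncomputable def ofFockU2 (m : ℤ) (ι : FockPoly →ₗ[ℂ] E) (c : ℂ) (hι : ι Delta ≠ 0) (hc : c ≠ 0)
    (μ : Measure H) (rep : H → Matrix (Fin 2) (Fin 2) ℂ)
    (rep_mem : ∀ g, rep g ∈ Matrix.unitaryGroup (Fin 2) ℂ)
    (rep_measurable : ∀ i j, Measurable fun g => rep g i j) (Lfac : ℂ → ℂ) :
    ArchDoublingDatum H (· ∈ Matrix.unitaryGroup (Fin 2) ℂ) where
  μ := μ
  rep := rep
  rep_mem := rep_mem
  rep_measurable := rep_measurable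
  coeffW g := ⟪ι Delta, ι (fockActU2 m (rep g) Delta)⟫_ℂ
  coeffπ g := ⟪ι (c • Delta), ι (fockActU2 m (rep g) (c • Delta))⟫_ℂ
  normφ := ‖ι Delta‖
  normf := ‖ι (c • Delta)‖
  normφ_pos := norm_pos_iff.mpr hι
  normf_pos := by
    rw [map_smul, norm_smul]
    exact mul_pos (norm_pos_iff.mpr hc) (norm_pos_iff.mpr hι)
  Lfac := Lfac

/-- (N4.3.P2) at τ′₁ holds BY CONSTRUCTION on the explicit compact datum: no hypothesis beyond the
datum's own fields (`characterCoefficient_of_fockU2` with its four identities `rfl`). -/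
theorem ofFockU2_characterCoefficient (m : ℤ) (ι : FockPoly →ₗ[ℂ] E) (c : ℂ) (hι : ι Delta ≠ 0)
    (hc : c ≠ 0) (μ : Measure H) (rep : H → Matrix (Fin 2) (Fin 2) ℂ)
    (rep_mem : ∀ g, rep g ∈ Matrix.unitaryGroup (Fin 2) ℂ)
    (rep_measurable : ∀ i j, Measurable fun g => rep g i j) (Lfac : ℂ → ℂ) :
    (ofFockU2 m ι c hι hc μ rep rep_mem rep_measurable Lfac).CharacterCoefficient m :=
  characterCoefficient_of_fockU2 _ m rep_mem ι c (fun _ => rfl) (fun _ => rfl) rfl rfl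

end ArchDoublingDatum

namespace N43Places

/-- The explicit local data at a (1,1)-place (τ′₂ or τ′₃): a Fock-line datum on a Hilbert space with
its two vectors non-zero, the Haar measure, the matrix map into `U(1,1)`, the L-factor and the
Eischen–Liu weight / twist parameters. DATA only (no field asserts a printed theorem). -/
structure ExplicitU11 where
  /-- the group carrier -/
  H : Type
  /-- its measurable structure -/
  [meas : MeasurableSpace H]
  /-- the Hilbert space carrying the Fock-line action -/
  E : Type
  [normed : NormedAddCommGroup E]
  [inner : InnerProductSpace ℂ E]
  /-- the Fock-line datum (`ω`, `φ`, `f = c • φ`) -/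
  F : FockLineDatum H E
  hφ : F.φ ≠ 0
  hf : F.f ≠ 0
  /-- the Haar measure -/
  μ : Measure H
  /-- the matrices of `H` in the adapted basis -/
  rep : H → Matrix (Fin 2) (Fin 2) ℂ
  rep_mem : ∀ g, T5UnitaryBound.MemU11 (rep g)
  rep_measurable : ∀ i j, Measurable fun g => rep g i j
  /-- the archimedean L-factor -/
  Lfac : ℂ → ℂ
  /-- the Eischen–Liu weight `τ` (signature (1,1)) -/
  τ : Fin 1 → ℤ
  /-- the Eischen–Liu weight `ν` -/
  ν : Fin 1 → ℤ
  /-- the Eischen–Liu twist `r` -/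
  r : ℤ

namespace ExplicitU11

variable (X : ExplicitU11)

/-- The measurable structure of the carrier, as an instance. -/
instance instMeasurableSpace : MeasurableSpace X.H := X.meas
/-- The normed group structure of the Hilbert space, as an instance. -/
instance instNormedAddCommGroup : NormedAddCommGroup X.E := X.normed
/-- The inner product structure of the Hilbert space, as an instance. -/
instance instInnerProductSpace : InnerProductSpace ℂ X.E := X.inner

/-- The explicit doubling datum of the place (`ArchDoublingDatum.ofFockLine`). -/
noncomputable def datum : ArchDoublingDatum X.H T5UnitaryBound.MemU11 :=
  ArchDoublingDatum.ofFockLine X.F X.hφ X.hf X.μ X.rep X.rep_mem X.rep_measurable X.Lfac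

/-- (N4.3.P2) on the explicit datum, with no hypothesis. -/
theorem datum_fockLineIdentification : X.datum.FockLineIdentification :=
  ArchDoublingDatum.ofFockLine_fockLineIdentification _ _ _ _ _ _ _ _

/-- The explicit datum's L-factor is the bundle's. -/
theorem datum_Lfac : X.datum.Lfac = X.Lfac := rfl

end ExplicitU11

/-- The explicit local data at the compact place τ′₁: the [KK07] action on the polynomial Fock model
read through `ι` into a Hilbert space, the integer `m = (m′₁ − 3)/2`, the forced-vector scalar `c`, the
probability Haar measure, the matrix map into `U(2)`, the L-factor and the Eischen–Liu parameters. DATA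
only. -/
structure ExplicitU2 where
  /-- the group carrier -/
  H : Type
  /-- its measurable structure -/
  [meas : MeasurableSpace H]
  /-- the Hilbert space receiving the Fock model -/
  E : Type
  [normed : NormedAddCommGroup E]
  [inner : InnerProductSpace ℂ E]
  /-- the integer `(m′₁ − 3)/2` of (N4.3.P2) at τ′₁ -/
  m : ℤ
  /-- the Fock inner product, read through a linear map into `E` -/
  ι : FockPoly →ₗ[ℂ] E
  /-- the scalar with `f = c • Δ` -/
  c : ℂ
  hι : ι Delta ≠ 0
  hc : c ≠ 0
  /-- the Haar measure -/
  μ : Measure H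
  /-- normalised to total mass 1 (TIER5 l. 1251) -/
  prob : IsProbabilityMeasure μ
  /-- the matrices of `H` in the adapted basis -/
  rep : H → Matrix (Fin 2) (Fin 2) ℂ
  rep_mem : ∀ g, rep g ∈ Matrix.unitaryGroup (Fin 2) ℂ
  rep_measurable : ∀ i j, Measurable fun g => rep g i j
  /-- the archimedean L-factor -/
  Lfac : ℂ → ℂ
  /-- the Eischen–Liu weight `τ` (signature (2,0)) -/
  τ : Fin 2 → ℤ
  /-- the Eischen–Liu weight `ν` (signature (2,0): empty) -/
  ν : Fin 0 → ℤ
  /-- the Eischen–Liu twist `r` -/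
  r : ℤ

namespace ExplicitU2

variable (X : ExplicitU2)

/-- The measurable structure of the carrier, as an instance. -/
instance instMeasurableSpace : MeasurableSpace X.H := X.meas
/-- The normed group structure of the Hilbert space, as an instance. -/
instance instNormedAddCommGroup : NormedAddCommGroup X.E := X.normed
/-- The inner product structure of the Hilbert space, as an instance. -/
instance instInnerProductSpace : InnerProductSpace ℂ X.E := X.inner

/-- The explicit doubling datum of the compact place (`ArchDoublingDatum.ofFockU2`). -/
noncomputable def datum : ArchDoublingDatum X.H (· ∈ Matrix.unitaryGroup (Fin 2) ℂ) :=
  ArchDoublingDatum.ofFockU2 X.m X.ι X.c X.hι X.hc X.μ X.rep X.rep_mem X.rep_measurable X.Lfac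

/-- (N4.3.P2) at τ′₁ on the explicit datum, with no hypothesis. -/
theorem datum_characterCoefficient : X.datum.CharacterCoefficient X.m :=
  ArchDoublingDatum.ofFockU2_characterCoefficient _ _ _ _ _ _ _ _ _ _

/-- The explicit datum's measure is the bundle's probability measure. -/
theorem datum_prob : IsProbabilityMeasure X.datum.μ := X.prob

/-- The explicit datum's L-factor is the bundle's. -/
theorem datum_Lfac : X.datum.Lfac = X.Lfac := rfl

end ExplicitU2

/-- The three real places with EXPLICIT local data: τ′₁ compact (`ExplicitU2`), τ′₂ and τ′₃ of signature
(1,1) (`ExplicitU11`). -/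
structure ExplicitPlaces where
  /-- the compact place τ′₁ -/
  p₁ : ExplicitU2
  /-- the place τ′₂ -/
  p₂ : ExplicitU11
  /-- the place τ′₃ -/
  p₃ : ExplicitU11

namespace ExplicitPlaces

variable (X : ExplicitPlaces)

/-- The abstract bundle `N43Places` of an explicit one (the M2 carrier's `d43` when its local data are
explicit). -/
noncomputable def toPlaces : N43Places where
  H₁ := X.p₁.H
  meas₁ := X.p₁.meas
  d₁ := X.p₁.datum
  prob₁ := X.p₁.datum_prob
  m := X.p₁.m
  τ₁ := X.p₁.τ
  ν₁ := X.p₁.ν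
  r₁ := X.p₁.r
  H₂ := X.p₂.H
  meas₂ := X.p₂.meas
  d₂ := X.p₂.datum
  τ₂ := X.p₂.τ
  ν₂ := X.p₂.ν
  r₂ := X.p₂.r
  H₃ := X.p₃.H
  meas₃ := X.p₃.meas
  d₃ := X.p₃.datum
  τ₃ := X.p₃.τ
  ν₃ := X.p₃.ν
  r₃ := X.p₃.r

/-- The local data of the abstract bundle are the explicit ones (`rfl` evaluation lemmas). -/
theorem toPlaces_d₁ : X.toPlaces.d₁ = X.p₁.datum := rfl
/-- τ′₂. -/
theorem toPlaces_d₂ : X.toPlaces.d₂ = X.p₂.datum := rfl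
/-- τ′₃. -/
theorem toPlaces_d₃ : X.toPlaces.d₃ = X.p₃.datum := rfl

/-- THEOREM N4.3 (a)–(c) at all three places ON EXPLICIT DATA: the (I-P2) binders of `N43_places` are
gone (discharged by construction); what remains is the displays `Hyp.EischenLiu2024_Sec2_2` (×3, on the
bundle's own L-factors) and `Hyp.Ruhl1970_A2f` (×2), and the interface residual
`LowestWeightCoefficient` (×2, class IR). -/
theorem N43_places_explicit
    (hEL₁ : Hyp.EischenLiu2024_Sec2_2 2 0 X.p₁.τ X.p₁.ν X.p₁.r X.p₁.Lfac)
    (hP2'₂ : X.p₂.datum.LowestWeightCoefficient) (hA2f₂ : Hyp.Ruhl1970_A2f X.p₂.datum)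
    (hEL₂ : Hyp.EischenLiu2024_Sec2_2 1 1 X.p₂.τ X.p₂.ν X.p₂.r X.p₂.Lfac)
    (hP2'₃ : X.p₃.datum.LowestWeightCoefficient) (hA2f₃ : Hyp.Ruhl1970_A2f X.p₃.datum)
    (hEL₃ : Hyp.EischenLiu2024_Sec2_2 1 1 X.p₃.τ X.p₃.ν X.p₃.r X.p₃.Lfac) :
    (∀ j : Fin 3, 0 < (X.toPlaces.zetaAt j).re) ∧ X.toPlaces.ArchNonvanishing :=
  X.toPlaces.N43_places X.p₁.datum_characterCoefficient hEL₁ X.p₂.datum_fockLineIdentification hP2'₂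
    hA2f₂ hEL₂ X.p₃.datum_fockLineIdentification hP2'₃ hA2f₃ hEL₃

/-- The archimedean non-vanishing alone, on explicit data. -/
theorem archNonvanishing_explicit
    (hEL₁ : Hyp.EischenLiu2024_Sec2_2 2 0 X.p₁.τ X.p₁.ν X.p₁.r X.p₁.Lfac)
    (hP2'₂ : X.p₂.datum.LowestWeightCoefficient) (hA2f₂ : Hyp.Ruhl1970_A2f X.p₂.datum)
    (hEL₂ : Hyp.EischenLiu2024_Sec2_2 1 1 X.p₂.τ X.p₂.ν X.p₂.r X.p₂.Lfac)
    (hP2'₃ : X.p₃.datum.LowestWeightCoefficient) (hA2f₃ : Hyp.Ruhl1970_A2f X.p₃.datum)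
    (hEL₃ : Hyp.EischenLiu2024_Sec2_2 1 1 X.p₃.τ X.p₃.ν X.p₃.r X.p₃.Lfac) :
    X.toPlaces.ArchNonvanishing :=
  (X.N43_places_explicit hEL₁ hP2'₂ hA2f₂ hEL₂ hP2'₃ hA2f₃ hEL₃).2

/-- THEOREM N4.3 on explicit data with the L-factors RE-POINTED at a global datum's archimedean factors
`L j` (the M2 carrier's `NSide.arch = d43.withLfac (fun j => d41.Lv (Sum.inr j))`, T6N43Lfac /
T6N43Contract): the Eischen–Liu displays are stated on the `L j`, the (I-P2) binders are gone. -/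
theorem N43_places_explicit_withLfac (L : Fin 3 → ℂ → ℂ)
    (hEL₁ : Hyp.EischenLiu2024_Sec2_2 2 0 X.p₁.τ X.p₁.ν X.p₁.r (L 0))
    (hP2'₂ : X.p₂.datum.LowestWeightCoefficient) (hA2f₂ : Hyp.Ruhl1970_A2f X.p₂.datum)
    (hEL₂ : Hyp.EischenLiu2024_Sec2_2 1 1 X.p₂.τ X.p₂.ν X.p₂.r (L 1))
    (hP2'₃ : X.p₃.datum.LowestWeightCoefficient) (hA2f₃ : Hyp.Ruhl1970_A2f X.p₃.datum)
    (hEL₃ : Hyp.EischenLiu2024_Sec2_2 1 1 X.p₃.τ X.p₃.ν X.p₃.r (L 2)) :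
    (∀ j : Fin 3, 0 < ((X.toPlaces.withLfac L).zetaAt j).re) ∧
      (X.toPlaces.withLfac L).ArchNonvanishing :=
  X.toPlaces.N43_places_withLfac L X.p₁.datum_characterCoefficient hEL₁
    X.p₂.datum_fockLineIdentification hP2'₂ hA2f₂ hEL₂ X.p₃.datum_fockLineIdentification hP2'₃
    hA2f₃ hEL₃

end ExplicitPlaces

end N43Places

namespace ArchDoublingDatum

variable {H : Type*} [MeasurableSpace H]

/-- The (A-2f) display depends on the datum only through its measure and its matrix map: it transfers
along equal `μ` and `rep`. -/
theorem ruhl_A2f_of_eq {𝒟 𝒟' : ArchDoublingDatum H T5UnitaryBound.MemU11} (hμ : 𝒟.μ = 𝒟'.μ)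
    (hrep : 𝒟.rep = 𝒟'.rep) (h : Hyp.Ruhl1970_A2f 𝒟) : Hyp.Ruhl1970_A2f 𝒟' := by
  obtain ⟨c, hc, h⟩ := h
  refine ⟨c, hc, ?_⟩
  have heta : 𝒟'.eta = 𝒟.eta := by
    funext g
    simp only [ArchDoublingDatum.eta, hrep]
  rw [heta, ← hμ]
  exact h

end ArchDoublingDatum

end Summit.Ventures.HodgeRepro2.T6
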